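import Literature.Analysis.PDE.QuasilinearConvergence
import HarnessLib

/-!
# The frozen Picard scheme: regularity of the chart limits (topic `Analysis/PDE`)

Layer (III), step 5d, of the programme to prove short-time existence for quasilinear strictly
parabolic systems on a closed manifold (hypothesis `hQL` of
`Literature.Geometry.Riemannian.ricciFlow_shortTime_existence_of_quasilinear`). The chart limits
`F_q` of the Picard scheme (`QuasilinearConvergence.lean`) satisfy, word by word on the inner ball
`B(0, 2r_q)`, the equation `∂ₜ ∂_β F_q = ∂_β (L̃ F_q + Θl_q)` (`QuasilinearLimit.lean`), and the
right-hand side is a global smooth function of the point and the frame `2`-jet of `F_q`; the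
nonlinear tower (`JetTower.lean`) then makes `F_q` jointly smooth on `[0, T] × B(0, 2r_q)`.

* globalised frozen fields `globS/globB/globC` and the jet forms `jetFormL`, `jetFormN` of the
  frame operator and of the flat Picard source, with the exact identities
  `jetFormL_jetW`, `jetFormN_jetW`;
* `PicardData.chart_limit_regular`.

Everything is proved; no named fact and no `sorry` is introduced.

## References

* M. E. Taylor, *Partial Differential Equations III*, 2nd ed., Springer 2011, Ch. 15, §7.
  [TaylorPDEIII2011]
-/

noncomputable section

open Set Function Filter Topology Metric MeasureTheory InnerProductSpace
open scoped Manifold ContDiff Topology ENNReal RealInnerProductSpace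

namespace Literature.Analysis.PDE

open Literature.Geometry.Manifold Literature.Analysis.FunctionSpaces Literature.Analysis.FluidPDE JetTower

variable {E' : Type*} [NormedAddCommGroup E'] [InnerProductSpace ℝ E'] [FiniteDimensional ℝ E']
variable {W' : Type*} [NormedAddCommGroup W'] [InnerProductSpace ℝ W']

/-! ### Jet forms of the frame operator and of the flat source -/

/-- The index of the empty word. [folklore] -/
def idx0 : JIdx E' 2 := ⟨0, Fin.elim0⟩
/-- The index of the word `[a]`. [folklore] -/
def idx1 (a : Fin (Module.finrank ℝ E')) : JIdx E' 2 := ⟨1, ![a]⟩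
/-- The index of the word `[a, b]`. [folklore] -/
def idx2 (a b : Fin (Module.finrank ℝ E')) : JIdx E' 2 := ⟨2, ![a, b]⟩

/-- `wordOf_idx0`: the empty word. [folklore] -/
@[simp] theorem wordOf_idx0 : wordOf (idx0 : JIdx E' 2) = [] := rfl
/-- `wordOf_idx1`: the one-letter word. [folklore] -/
@[simp] theorem wordOf_idx1 (a : Fin (Module.finrank ℝ E')) : wordOf (idx1 a : JIdx E' 2) = [stdOrthonormalBasis ℝ E' a] := by
  simp [wordOf, idx1, List.ofFn_succ]
/-- `wordOf_idx2`: the two-letter word. [folklore] -/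
@[simp] theorem wordOf_idx2 (a b : Fin (Module.finrank ℝ E')) : wordOf (idx2 a b : JIdx E' 2) = [stdOrthonormalBasis ℝ E' a, stdOrthonormalBasis ℝ E' b] := by
  simp [wordOf, idx2, List.ofFn_succ]

/-- The `1`-jet operator from the frame `1`-jet: `Σₐ ⟪eₐ, ·⟫ ⊗ J_[a]`. [folklore] -/
def jetD (J : Jet E' 2 W') : E' →L[ℝ] W' := ∑ a, (innerSL ℝ (stdOrthonormalBasis ℝ E' a)).smulRight (J (idx1 a))

/-- `jetD` of the jet of `z` is `Dz`. [folklore] -/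
theorem jetD_jetW (z : E' → W') (y : E') : jetD (jetW 2 z y) = fderiv ℝ z y := by
  rw [ParabolicTower.fderiv_eq_sum_smulRight, jetD]
  refine Finset.sum_congr rfl fun a _ ↦ ?_
  rw [jetW_apply, wordOf_idx1, iterDirDeriv_singleton_apply]

/-- `jetD` is a continuous linear map of the jet. [folklore] -/
theorem jetD_eq_clm : ∃ L : Jet E' 2 W' →L[ℝ] (E' →L[ℝ] W'), ∀ J, jetD J = L J := by
  refine ⟨∑ a, (ContinuousLinearMap.smulRightL ℝ E' W' (innerSL ℝ (stdOrthonormalBasis ℝ E' a))).comp (ContinuousLinearMap.proj (idx1 a)), fun J ↦ ?_⟩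
  simp [jetD]

/-- **The jet form of the frame operator**:
`Φ_L(y, J) = Σ_{ab} ⟪e_a, S y e_b⟫ J_[a,b] + 𝔟 y (Σ_a ⟪e_a, ·⟫ ⊗ J_[a]) + 𝔠 y J_[]`. [folklore] -/
def jetFormL (S : E' → (E' →L[ℝ] E')) (𝔟 : E' → ((E' →L[ℝ] W') →L[ℝ] W')) (𝔠 : E' → (W' →L[ℝ] W')) (q : E' × Jet E' 2 W') : W' :=
  (∑ a, ∑ b, ⟪stdOrthonormalBasis ℝ E' a, S q.1 (stdOrthonormalBasis ℝ E' b)⟫ • q.2 (idx2 a b)) + 𝔟 q.1 (jetD q.2) + 𝔠 q.1 (q.2 idx0)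

/-- **The jet form represents the frame operator exactly.** [folklore] -/
theorem jetFormL_jetW (S : E' → (E' →L[ℝ] E')) (𝔟 : E' → ((E' →L[ℝ] W') →L[ℝ] W')) (𝔠 : E' → (W' →L[ℝ] W')) (u : E' → W') (y : E') :
    jetFormL S 𝔟 𝔠 (y, jetW 2 u y) = frameOp (S y) (𝔟 y) (𝔠 y) u y := by
  rw [frameOp_apply, principalPart_apply, jetFormL, jetD_jetW]
  have h2 : ∀ a b, jetW 2 u y (idx2 a b) = fderiv ℝ (fun z ↦ fderiv ℝ u z (stdOrthonormalBasis ℝ E' b)) y (stdOrthonormalBasis ℝ E' a) := by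
    intro a b; rw [jetW_apply, wordOf_idx2, iterDirDeriv_cons]; rfl
  have h0 : jetW 2 u y idx0 = u y := by rw [jetW_apply, wordOf_idx0, iterDirDeriv_nil]
  simp only [h2, h0]

/-- The jet form of the frame operator is smooth for smooth global fields. [folklore] -/
theorem contDiff_jetFormL {S : E' → (E' →L[ℝ] E')} {𝔟 : E' → ((E' →L[ℝ] W') →L[ℝ] W')} {𝔠 : E' → (W' →L[ℝ] W')}
    (hS : ContDiff ℝ ∞ S) (h𝔟 : ContDiff ℝ ∞ 𝔟) (h𝔠 : ContDiff ℝ ∞ 𝔠) : ContDiff ℝ ∞ (jetFormL (W' := W') S 𝔟 𝔠) := by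
  obtain ⟨L, hL⟩ := jetD_eq_clm (E' := E') (W' := W')
  have hD : ContDiff ℝ ∞ fun q : E' × Jet E' 2 W' ↦ jetD q.2 := by
    have : (fun q : E' × Jet E' 2 W' ↦ jetD q.2) = fun q ↦ L q.2 := funext fun q ↦ hL q.2
    rw [this]; exact L.contDiff.comp contDiff_snd
  have hproj : ∀ i : JIdx E' 2, ContDiff ℝ ∞ fun q : E' × Jet E' 2 W' ↦ q.2 i := fun i ↦
    (ContinuousLinearMap.proj (R := ℝ) (φ := fun _ : JIdx E' 2 ↦ W') i).contDiff.comp contDiff_snd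
  unfold jetFormL
  refine ((ContDiff.sum fun a _ ↦ ContDiff.sum fun b _ ↦ ?_).add ((h𝔟.comp contDiff_fst).clm_apply hD)).add ((h𝔠.comp contDiff_fst).clm_apply (hproj _))
  exact (contDiff_const.inner ℝ ((hS.comp contDiff_fst).clm_apply contDiff_const)).smul (hproj _)

section FlatForm

variable {ι : Type*} [Fintype ι]

/-- **The jet form of the flat Picard source**:
`Φ_N(y, J) = cut y • (Σᵢᵢ' Gᶜᵢᵢ'(y, (J_[], D(J))) Σ_{ab} ⟪e_a, Avᵢ⟫⟪e_b, Avᵢ'⟫ J_[a,b] + Gʳ(y, (J_[], D(J)))) + g₀ y`.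
[folklore] -/
def jetFormN (Av : ι → E') (cut : E' → ℝ) (Gc : ι → ι → (E' × (W' × (E' →L[ℝ] W')) → ℝ))
    (Gr : E' × (W' × (E' →L[ℝ] W')) → W') (g₀ : E' → W') (q : E' × Jet E' 2 W') : W' :=
  cut q.1 • ((∑ i, ∑ i', Gc i i' (q.1, (q.2 idx0, jetD q.2)) •
      ∑ a, ∑ b, (⟪stdOrthonormalBasis ℝ E' a, Av i⟫ * ⟪stdOrthonormalBasis ℝ E' b, Av i'⟫) • q.2 (idx2 a b)) +
    Gr (q.1, (q.2 idx0, jetD q.2))) + g₀ q.1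

/-- **The jet form represents the flat source exactly** (smooth `z`). [folklore] -/
theorem jetFormN_jetW (Av : ι → E') (cut : E' → ℝ) (Gc : ι → ι → (E' × (W' × (E' →L[ℝ] W')) → ℝ))
    (Gr : E' × (W' × (E' →L[ℝ] W')) → W') (g₀ : E' → W') {z : E' → W'} (hz : ContDiff ℝ ∞ z) (y : E') :
    jetFormN Av cut Gc Gr g₀ (y, jetW 2 z y) = thetaFlat Av cut Gc Gr g₀ z y := by
  have hD : DifferentiableAt ℝ (fderiv ℝ z) y := ((hz.fderiv_right (m := ∞) (by norm_cast)).differentiable (by simp)) y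
  rw [thetaFlat, jetFormN, jetD_jetW]
  have h2 : ∀ a b, jetW 2 z y (idx2 a b) = fderiv ℝ (fun w ↦ fderiv ℝ z w (stdOrthonormalBasis ℝ E' b)) y (stdOrthonormalBasis ℝ E' a) := by
    intro a b; rw [jetW_apply, wordOf_idx2, iterDirDeriv_cons]; rfl
  have h0 : jetW 2 z y idx0 = z y := by rw [jetW_apply, wordOf_idx0, iterDirDeriv_nil]
  simp only [h2, h0, jetOf_apply]
  congr 1
  congr 1
  congr 1
  refine Finset.sum_congr rfl fun i _ ↦ Finset.sum_congr rfl fun i' _ ↦ ?_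
  rw [hess_apply_eq_sum hD]

/-- The jet form of the flat source is smooth for smooth global data. [folklore] -/
theorem contDiff_jetFormN (Av : ι → E') {cut : E' → ℝ} (hcut : ContDiff ℝ ∞ cut) {Gc : ι → ι → (E' × (W' × (E' →L[ℝ] W')) → ℝ)}
    (hGc : ∀ i i', ContDiff ℝ ∞ (Gc i i')) {Gr : E' × (W' × (E' →L[ℝ] W')) → W'} (hGr : ContDiff ℝ ∞ Gr) {g₀ : E' → W'} (hg₀ : ContDiff ℝ ∞ g₀) :
    ContDiff ℝ ∞ (jetFormN Av cut Gc Gr g₀) := by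
  obtain ⟨L, hL⟩ := jetD_eq_clm (E' := E') (W' := W')
  have hproj : ∀ i : JIdx E' 2, ContDiff ℝ ∞ fun q : E' × Jet E' 2 W' ↦ q.2 i := fun i ↦
    (ContinuousLinearMap.proj (R := ℝ) (φ := fun _ : JIdx E' 2 ↦ W') i).contDiff.comp contDiff_snd
  have hJ : ContDiff ℝ ∞ fun q : E' × Jet E' 2 W' ↦ ((q.1, (q.2 idx0, jetD q.2)) : E' × (W' × (E' →L[ℝ] W'))) := by
    have : (fun q : E' × Jet E' 2 W' ↦ jetD q.2) = fun q ↦ L q.2 := funext fun q ↦ hL q.2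
    refine contDiff_fst.prodMk ((hproj _).prodMk ?_)
    rw [this]; exact L.contDiff.comp contDiff_snd
  unfold jetFormN
  refine ((hcut.comp contDiff_fst).smul ((ContDiff.sum fun i _ ↦ ContDiff.sum fun i' _ ↦ ((hGc i i').comp hJ).smul
    (ContDiff.sum fun a _ ↦ ContDiff.sum fun b _ ↦ contDiff_const.smul (hproj _))).add (hGr.comp hJ))).add (hg₀.comp contDiff_fst)

end FlatForm

/-! ### Energies of pointwise limits (Fatou) -/

section Fatou

variable [MeasurableSpace E'] [BorelSpace E']

/-- The energy as one integral of the sum over frame words. [folklore] -/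
theorem sobolevEnergy_eq_lintegral_sum_words (k : ℕ) {f : E' → W'} (hf : ContDiff ℝ ∞ f) :
    sobolevEnergy k f = ∫⁻ y, ∑ i ∈ Finset.range (k + 1), ∑ β : Fin i → Fin (Module.finrank ℝ E'),
      ‖iterDirDeriv (List.ofFn fun l ↦ stdOrthonormalBasis ℝ E' (β l)) f y‖ₑ ^ 2 := by
  rw [sobolevEnergy_eq_sum_words, lintegral_finsetSum' _ fun i _ ↦ ?_]
  · refine Finset.sum_congr rfl fun i _ ↦ ?_
    rw [lintegral_finsetSum' _ fun β _ ↦ ?_]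
    exact ((continuous_enorm.comp (contDiff_iterDirDeriv hf _).continuous).measurable.pow_const 2).aemeasurable
  · exact Finset.aemeasurable_fun_sum _ fun β _ ↦ ((continuous_enorm.comp (contDiff_iterDirDeriv hf _).continuous).measurable.pow_const 2).aemeasurable

/-- **Energies of pointwise limits** (Fatou): if all frame-word derivatives of the smooth `f N`
converge pointwise to those of the smooth `F` and `E_k(f N) ≤ C` for all `N`, then `E_k(F) ≤ C`.
[folklore] -/
theorem sobolevEnergy_le_of_tendsto (k : ℕ) {f : ℕ → E' → W'} {F : E' → W'} (hf : ∀ N, ContDiff ℝ ∞ (f N)) (hF : ContDiff ℝ ∞ F)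
    (hlim : ∀ (β : List E') (y : E'), Tendsto (fun N ↦ iterDirDeriv β (f N) y) atTop (𝓝 (iterDirDeriv β F y)))
    {C : ℝ≥0∞} (hC : ∀ N, sobolevEnergy k (f N) ≤ C) : sobolevEnergy k F ≤ C := by
  set Ψ : ℕ → E' → ℝ≥0∞ := fun N y ↦ ∑ i ∈ Finset.range (k + 1), ∑ β : Fin i → Fin (Module.finrank ℝ E'),
      ‖iterDirDeriv (List.ofFn fun l ↦ stdOrthonormalBasis ℝ E' (β l)) (f N) y‖ₑ ^ 2 with hΨ
  have hΨm : ∀ N, Measurable (Ψ N) := fun N ↦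
    Finset.measurable_sum _ fun i _ ↦ Finset.measurable_sum _ fun β _ ↦ (continuous_enorm.comp (contDiff_iterDirDeriv (hf N) _).continuous).measurable.pow_const 2
  have hptw : ∀ y, Tendsto (fun N ↦ Ψ N y) atTop (𝓝 (∑ i ∈ Finset.range (k + 1), ∑ β : Fin i → Fin (Module.finrank ℝ E'),
      ‖iterDirDeriv (List.ofFn fun l ↦ stdOrthonormalBasis ℝ E' (β l)) F y‖ₑ ^ 2)) := by
    intro y
    refine tendsto_finsetSum _ fun i _ ↦ tendsto_finsetSum _ fun β _ ↦ ?_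
    exact ((ENNReal.continuous_pow 2).tendsto _).comp ((continuous_enorm.tendsto _).comp (hlim _ y))
  rw [sobolevEnergy_eq_lintegral_sum_words k hF]
  calc (∫⁻ y, ∑ i ∈ Finset.range (k + 1), ∑ β : Fin i → Fin (Module.finrank ℝ E'), ‖iterDirDeriv (List.ofFn fun l ↦ stdOrthonormalBasis ℝ E' (β l)) F y‖ₑ ^ 2)
      = ∫⁻ y, liminf (fun N ↦ Ψ N y) atTop := lintegral_congr fun y ↦ ((hptw y).liminf_eq).symm
    _ ≤ liminf (fun N ↦ ∫⁻ y, Ψ N y) atTop := lintegral_liminf_le hΨm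
    _ = liminf (fun N ↦ sobolevEnergy k (f N)) atTop := by
        refine Filter.liminf_congr (Filter.Eventually.of_forall fun N ↦ ?_)
        rw [sobolevEnergy_eq_lintegral_sum_words k (hf N)]
    _ ≤ C := Filter.liminf_le_of_frequently_le' (Filter.Frequently.of_forall hC)

end Fatou

/-! ### Shifting a uniformly convergent sequence -/

omit [FiniteDimensional ℝ E'] in
/-- Shifting the index preserves uniform convergence. [folklore] -/
theorem tendstoUniformlyOn_succ {α V : Type*} [PseudoMetricSpace V] {Fs : ℕ → α → V} {f : α → V} {s : Set α}
    (h : TendstoUniformlyOn Fs f atTop s) : TendstoUniformlyOn (fun N ↦ Fs (N + 1)) f atTop s := by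
  rw [Metric.tendstoUniformlyOn_iff] at h ⊢
  intro ε hε
  exact (tendsto_add_atTop_nat 1).eventually (h ε hε)

/-! ### Regularity of the chart limits -/

section Charts

variable [MeasurableSpace E'] [BorelSpace E'] [FiniteDimensional ℝ W']
variable {E : Type*} [NormedAddCommGroup E] [NormedSpace ℝ E] {H : Type*} [TopologicalSpace H]
variable {I : ModelWithCorners ℝ E H} {M : Type*} [TopologicalSpace M] [ChartedSpace H M]
variable {ιb : Type*} [Fintype ιb] {ι : Type*} [Fintype ι]
variable [I.Boundaryless] [HasContDiffBump E'] [CompactSpace M] [T2Space M] [IsManifold I ∞ M]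
variable (D : PicardData I M E' W' ιb ι)

/-- **Globalised frozen field** `1 + cutPlus_q • (S₀ - 1)`. [folklore] -/
def PicardData.globS (q : ι) (S₀ : E' → (E' →L[ℝ] E')) (y : E') : E' →L[ℝ] E' := 1 + D.PS.cutPlus q y • (S₀ y - 1)
/-- **Globalised frozen field** `cutPlus_q • 𝔟₀`. [folklore] -/
def PicardData.globB (q : ι) (𝔟₀ : E' → ((E' →L[ℝ] W') →L[ℝ] W')) (y : E') : (E' →L[ℝ] W') →L[ℝ] W' := D.PS.cutPlus q y • 𝔟₀ y
/-- **Globalised frozen field** `cutPlus_q • 𝔠₀`. [folklore] -/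
def PicardData.globC (q : ι) (𝔠₀ : E' → (W' →L[ℝ] W')) (y : E') : W' →L[ℝ] W' := D.PS.cutPlus q y • 𝔠₀ y

set_option maxHeartbeats 4000000 in
/-- **Regularity of the chart limits.** In the situation of `exists_word_limits`, with the frozen
linear operator represented in the charts by smooth fields `S₀, 𝔟₀, 𝔠₀`, for every chart `q` the
limit `F_q` of the cut-off chart expressions is jointly `C^∞` on `[0, T] × B(0, 2r_q)` and solves
there `∂ₜ F_q = frameOp(S₀, 𝔟₀, 𝔠₀) F_q + Θ♭_q(F_q)` within `[0, T]`, and it is the pointwise limit of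
the cut-off chart expressions. [cite: TaylorPDEIII2011, Ch. 15, §7] -/
theorem PicardData.chart_limit_regular {Clin : ℝ≥0∞} (hClin : Clin ≠ ⊤)
    (hAp : ∀ i : ℕ, ∃ Λ : ℝ, 1 ≤ Λ ∧ ∀ {lam : ℝ}, Λ ≤ lam → ∀ {T' : ℝ}, 0 < T' → T' ≤ 1 → ∀ {v g : ℝ → M → W'},
      (∀ q, ContDiffOn ℝ ∞ (uncurry fun s y ↦ v s ((D.PS.chart q).inv y)) (Icc 0 T' ×ˢ (D.PS.chart q).target)) →
      (∀ x, v 0 x = 0) →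
      (∀ q, ContDiffOn ℝ ∞ (uncurry fun s y ↦ g s ((D.PS.chart q).inv y)) (Icc 0 T' ×ˢ (D.PS.chart q).target)) →
      (∀ s ∈ Icc 0 T', ∀ x, derivWithin (fun s ↦ v s x) (Icc 0 T') s = linOp D.P D.u₀ (v s) x + g s x) →
      ∀ t ∈ Icc 0 T',
        (∑ p, PatchSystemLoc.maxRegQ i lam (fun s ↦ PatchSystemLoc.cutExpr D.PS p (v s)) t ≤
          Clin * ∑ p, ∫⁻ s in Ioo 0 t, ENNReal.ofReal (Real.exp (-2 * lam * s)) * sobolevEnergy i (PatchSystemLoc.cutExpr D.PS p (g s))) ∧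
        ∀ p, ENNReal.ofReal (Real.exp (-2 * lam * t)) * sobolevEnergy i (PatchSystemLoc.cutExpr D.PS p (v t)) ≤
          Clin * ENNReal.ofReal lam⁻¹ * ∑ p, ∫⁻ s in Ioo 0 t, ENNReal.ofReal (Real.exp (-2 * lam * s)) * sobolevEnergy i (PatchSystemLoc.cutExpr D.PS p (g s)))
    {S₀ : ι → E' → (E' →L[ℝ] E')} {𝔟₀ : ι → E' → ((E' →L[ℝ] W') →L[ℝ] W')} {𝔠₀ : ι → E' → (W' →L[ℝ] W')}
    (hS₀ : ∀ q, ContDiffOn ℝ ∞ (S₀ q) (D.PS.chart q).target) (h𝔟₀ : ∀ q, ContDiffOn ℝ ∞ (𝔟₀ q) (D.PS.chart q).target)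
    (h𝔠₀ : ∀ q, ContDiffOn ℝ ∞ (𝔠₀ q) (D.PS.chart q).target)
    (hL : ∀ u : M → W', (∀ q, ContDiffOn ℝ ∞ (u ∘ (D.PS.chart q).inv) (D.PS.chart q).target) →
      ∀ q, ∀ y ∈ (D.PS.chart q).target, linOp D.P D.u₀ u ((D.PS.chart q).inv y) = frameOp (S₀ q y) (𝔟₀ q y) (𝔠₀ q y) (u ∘ (D.PS.chart q).inv) y)
    {m₀ : ℕ} (hm₀ : 2 * (Module.finrank ℝ E' + 1) + 8 ≤ m₀) {T : ℝ} (hT0 : 0 < T) (hT1 : T ≤ 1) {ε₁ : ℝ} (hε₁ : 0 < ε₁)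
    {ε₀ : ℝ} (hε₁ε₀ : ε₁ ≤ ε₀) {Cs Cδ : ℝ} (hCδ0 : 0 ≤ Cδ) (hδ1 : Cδ * ε₁ ≤ 1)
    (htop : Clin * ((Fintype.card ι : ℝ≥0∞) * ENNReal.ofReal (D.ctop * (Cδ * ε₁) ^ 2)) ≤ ENNReal.ofReal 4⁻¹)
    (hsmall : ∀ {v : M → W'}, ContMDiff I 𝓘(ℝ, W') ∞ v → ∀ {ε : ℝ}, 0 ≤ ε → ε ≤ ε₀ →
      (∀ q, sobolevEnergy (m₀ + 2 * (Module.finrank ℝ E' + 1)) (PatchSystemLoc.cutExpr D.PS q v) ≤ ENNReal.ofReal (ε ^ 2)) →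
      (∀ x, (x, D.u₀ x + v x) ∈ D.𝒪) ∧
      (∀ p y, D.PS.cut p y ≠ 0 → jetQ (jetOf (v ∘ (D.PS.chart p).inv) y) ≤ D.ρ' ^ 2) ∧
      (∀ p, ∀ m ≤ m₀, ∀ y, ‖iteratedFDeriv ℝ m (PatchSystemLoc.zExpr D.PS p v) y‖ ≤ Cs * ε) ∧
      (∀ p i i' y, |D.Gc p i i' (y, jetOf (PatchSystemLoc.zExpr D.PS p v) y)| ≤ Cδ * ε))
    {v : ℕ → ℝ → M → W'}
    (hvs : ∀ k q, ContDiffOn ℝ ∞ (uncurry fun s y ↦ v k s ((D.PS.chart q).inv y)) (Icc 0 T ×ˢ (D.PS.chart q).target))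
    (hv0 : ∀ k x, v k 0 x = 0) (hv00 : ∀ s x, v 0 s x = 0)
    (heq : ∀ k, ∀ s ∈ Icc 0 T, ∀ x, derivWithin (fun s ↦ v (k + 1) s x) (Icc 0 T) s = linOp D.P D.u₀ (v (k + 1) s) x + D.theta (v k s) x)
    (hE0 : ∀ k, ∀ s ∈ Icc 0 T, ∀ q, sobolevEnergy (m₀ + 2 * (Module.finrank ℝ E' + 1)) (PatchSystemLoc.cutExpr D.PS q (v k s)) ≤ ENNReal.ofReal (ε₁ ^ 2))
    (q : ι) :
    ∃ F : ℝ → E' → W',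
      (∀ t ∈ Icc 0 T, ∀ y, Tendsto (fun N ↦ PatchSystemLoc.cutExpr D.PS q (v N t) y) atTop (𝓝 (F t y))) ∧
      (∀ β : List E', TendstoUniformlyOn (fun N (p : ℝ × E') ↦ iterDirDeriv β (PatchSystemLoc.cutExpr D.PS q (v N p.1)) p.2)
        (fun p ↦ iterDirDeriv β (F p.1) p.2) atTop (Icc 0 T ×ˢ univ)) ∧
      (∀ t ∈ Icc 0 T, ContDiff ℝ ∞ (F t)) ∧
      ContDiffOn ℝ ∞ (uncurry F) (Icc 0 T ×ˢ ball (0 : E') (2 * D.PS.r q)) ∧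
      ∀ t ∈ Icc 0 T, ∀ x ∈ ball (0 : E') (2 * D.PS.r q),
        HasDerivWithinAt (fun s ↦ F s x) (frameOp (S₀ q x) (𝔟₀ q x) (𝔠₀ q x) (F t) x + D.flat q (F t) x) (Icc 0 T) t := by
  classical
  /- ## linearity of `L` on chart-smooth maps -/
  have hLsub : ∀ u u' : M → W', (∀ q, ContDiffOn ℝ ∞ (u ∘ (D.PS.chart q).inv) (D.PS.chart q).target) →
      (∀ q, ContDiffOn ℝ ∞ (u' ∘ (D.PS.chart q).inv) (D.PS.chart q).target) →
      ∀ x, linOp D.P D.u₀ (fun x ↦ u x - u' x) x = linOp D.P D.u₀ u x - linOp D.P D.u₀ u' x := by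
    intro u u' hu hu' x
    obtain ⟨p, hxp, hpx⟩ := D.PS.cover x
    set y := (D.PS.chart p).map x with hy'
    have hy : y ∈ (D.PS.chart p).target := (D.PS.chart p).map_mem_target hxp
    have hy3 : y ∈ ball (0 : E') (3 * D.PS.r p) := ball_subset_ball (by linarith [D.PS.r_pos p]) hpx
    have hx : x = (D.PS.chart p).inv y := ((D.PS.chart p).inv_map hxp).symm
    have hsub : ∀ q, ContDiffOn ℝ ∞ ((fun x ↦ u x - u' x) ∘ (D.PS.chart q).inv) (D.PS.chart q).target := fun q ↦ (hu q).sub (hu' q)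
    rw [hx, hL _ hsub p _ hy, hL _ hu p _ hy, hL _ hu' p _ hy]
    have h1 : ContDiff ℝ ∞ (PatchSystemLoc.zExpr D.PS p u) := PatchSystemLoc.contDiff_zExpr D.PS p (hu p)
    have h2 : ContDiff ℝ ∞ (PatchSystemLoc.zExpr D.PS p u') := PatchSystemLoc.contDiff_zExpr D.PS p (hu' p)
    have e1 := PatchSystemLoc.zExpr_eventuallyEq D.PS p u hy3
    have e2 := PatchSystemLoc.zExpr_eventuallyEq D.PS p u' hy3
    have e3 : (fun z ↦ PatchSystemLoc.zExpr D.PS p u z - PatchSystemLoc.zExpr D.PS p u' z) =ᶠ[𝓝 y] ((fun x ↦ u x - u' x) ∘ (D.PS.chart p).inv) := by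
      filter_upwards [e1, e2] with z hz hz'
      simp only [hz, hz', Function.comp_apply]
    rw [← frameOp_congr_of_eventuallyEq _ _ _ e3, ← frameOp_congr_of_eventuallyEq _ _ _ e1, ← frameOp_congr_of_eventuallyEq _ _ _ e2]
    exact frameOp_sub_fun _ _ _ h1 h2 y
  /- ## slices -/
  have hslices : ∀ k, ∀ s ∈ Icc 0 T, ContMDiff I 𝓘(ℝ, W') ∞ (v k s) ∧ (∀ x, (x, D.u₀ x + v k s x) ∈ D.𝒪) ∧
      (∀ p y, D.PS.cut p y ≠ 0 → jetQ (jetOf (v k s ∘ (D.PS.chart p).inv) y) ≤ D.ρ' ^ 2) := by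
    intro k s hs
    have hvsm : ContMDiff I 𝓘(ℝ, W') ∞ (v k s) := PatchSystemLoc.contMDiff_of_chartSmooth D.PS (PatchSystemLoc.chartSmooth_slice D.PS (hvs k) hs)
    obtain ⟨hg, hj, -, -⟩ := hsmall hvsm hε₁.le hε₁ε₀ (hE0 k s hs)
    exact ⟨hvsm, hg, hj⟩
  have hΘs : ∀ k, ∀ p, ContDiffOn ℝ ∞ (uncurry fun s y ↦ D.theta (v k s) ((D.PS.chart p).inv y)) (Icc 0 T ×ˢ (D.PS.chart p).target) := fun k ↦
    D.theta_chartSlabSmooth' hT0 (hvs k) (fun s hs ↦ (hslices k s hs).1) (fun s hs ↦ (hslices k s hs).2.1)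
  /- ## the limits -/
  obtain ⟨F, Θl, ⟨hFs, hFu, hFc, hFlim, hFsm⟩, ⟨hΘls, hΘlu, hΘlc, hΘllim, hΘsm⟩⟩ :=
    D.exists_word_limits hClin hAp hLsub hm₀ hT0 hT1 hε₁ hε₁ε₀ hCδ0 hδ1 htop hsmall hvs hv0 hv00 heq hE0 q
  /- ## the globalised fields -/
  set gS : E' → (E' →L[ℝ] E') := D.globS q (S₀ q) with hgS
  set gB : E' → ((E' →L[ℝ] W') →L[ℝ] W') := D.globB q (𝔟₀ q) with hgB
  set gC : E' → (W' →L[ℝ] W') := D.globC q (𝔠₀ q) with hgC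
  have hTq := (D.PS.chart q).isOpen_target
  have hcPs : ContDiff ℝ ∞ (D.PS.cutPlus q : E' → ℝ) := (D.PS.cutPlus q).contDiff
  have hcPt : tsupport (D.PS.cutPlus q : E' → ℝ) ⊆ (D.PS.chart q).target := D.PS.tsupport_cutPlus_subset q
  have hgSs : ContDiff ℝ ∞ gS := by
    simp only [hgS]
    exact contDiff_const.add (contDiff_smul_of_tsupport_subset hTq hcPs hcPt ((hS₀ q).sub contDiffOn_const))
  have hgBs : ContDiff ℝ ∞ gB := contDiff_smul_of_tsupport_subset hTq hcPs hcPt (h𝔟₀ q)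
  have hgCs : ContDiff ℝ ∞ gC := contDiff_smul_of_tsupport_subset hTq hcPs hcPt (h𝔠₀ q)
  have hcP1 : ∀ y ∈ ball (0 : E') (3 * D.PS.r q), D.PS.cutPlus q y = 1 := fun y hy ↦
    ContDiffBump.one_of_mem_closedBall _ (by rw [PatchSystem.cutPlus_rIn]; exact ball_subset_closedBall hy)
  have hcP0 : ∀ y : E', 4 * D.PS.r q ≤ ‖y‖ → D.PS.cutPlus q y = 0 := by
    intro y hy
    have h : y ∉ Function.support (D.PS.cutPlus q : E' → ℝ) := by
      rw [ContDiffBump.support_eq, PatchSystem.cutPlus_rOut]; simpa using hy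
    simpa using h
  have hgS3 : ∀ y ∈ ball (0 : E') (3 * D.PS.r q), gS y = S₀ q y := fun y hy ↦ by simp [hgS, PicardData.globS, hcP1 y hy]
  have hgB3 : ∀ y ∈ ball (0 : E') (3 * D.PS.r q), gB y = 𝔟₀ q y := fun y hy ↦ by simp [hgB, PicardData.globB, hcP1 y hy]
  have hgC3 : ∀ y ∈ ball (0 : E') (3 * D.PS.r q), gC y = 𝔠₀ q y := fun y hy ↦ by simp [hgC, PicardData.globC, hcP1 y hy]
  have hgSc : ∀ (s : ℝ) (y : E'), 4 * D.PS.r q ≤ ‖y‖ → (fun (_ : ℝ) ↦ gS) s y = 1 := fun s y hy ↦ by simp [hgS, PicardData.globS, hcP0 y hy]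
  have hgBc : ∀ (s : ℝ) (y : E'), 4 * D.PS.r q ≤ ‖y‖ → (fun (_ : ℝ) ↦ gB) s y = 0 := fun s y hy ↦ by simp [hgB, PicardData.globB, hcP0 y hy]
  have hgCc : ∀ (s : ℝ) (y : E'), 4 * D.PS.r q ≤ ‖y‖ → (fun (_ : ℝ) ↦ gC) s y = 0 := fun s y hy ↦ by simp [hgC, PicardData.globC, hcP0 y hy]
  /- ## the approximating equations near the inner ball -/
  set f : ℕ → ℝ → E' → W' := fun N t ↦ PatchSystemLoc.cutExpr D.PS q (v (N + 1) t) with hf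
  set ΘN : ℕ → ℝ → E' → W' := fun N t ↦ PatchSystemLoc.zExpr D.PS q (D.theta (v N t)) with hΘN
  have hfsm : ∀ N, IsSmoothSpaceTimeOn (Icc 0 T) (f N) := fun N ↦ PatchSystemLoc.isSmoothSpaceTimeOn_cutExpr D.PS q (hvs (N + 1) q)
  have hΘNs : ∀ N, IsSmoothSpaceTimeOn (Icc 0 T) (ΘN N) := fun N ↦ PatchSystemLoc.isSmoothSpaceTimeOn_zExpr D.PS q (hΘs N q)
  -- near the inner ball the cut-offs are one
  have hcut1 : ∀ y ∈ ball (0 : E') (2 * D.PS.r q), D.PS.cut q y = 1 := fun y hy ↦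
    (D.PS.cut q).one_of_mem_closedBall (by rw [PatchSystem.cut_rIn]; exact ball_subset_closedBall hy)
  have hball2t : ball (0 : E') (2 * D.PS.r q) ⊆ (D.PS.chart q).target := D.PS.ball_subset_target q (by norm_num)
  have hball23 : ball (0 : E') (2 * D.PS.r q) ⊆ ball (0 : E') (3 * D.PS.r q) := ball_subset_ball (by linarith [D.PS.r_pos q])
  have hcutExpr_ev : ∀ (g : M → W') {y : E'}, y ∈ ball (0 : E') (2 * D.PS.r q) → PatchSystemLoc.cutExpr D.PS q g =ᶠ[𝓝 y] (g ∘ (D.PS.chart q).inv) := by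
    intro g y hy
    filter_upwards [isOpen_ball.mem_nhds hy] with z hz
    rw [PatchSystemLoc.cutExpr_of_mem D.PS g (hball2t hz), hcut1 z hz, one_smul]; rfl
  have heqN : ∀ N, ∀ s ∈ Icc 0 T, ∀ x ∈ ball (0 : E') (2 * D.PS.r q), timeDerivWithin (Icc 0 T) (f N) s =ᶠ[𝓝 x]
      fun y ↦ frameOp ((fun (_ : ℝ) ↦ gS) s y) ((fun (_ : ℝ) ↦ gB) s y) ((fun (_ : ℝ) ↦ gC) s y) (f N s) y + ΘN N s y := by
    intro N s hs x hx
    filter_upwards [isOpen_ball.mem_nhds hx] with y hy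
    have hyt : y ∈ (D.PS.chart q).target := hball2t hy
    have hy3 : y ∈ ball (0 : E') (3 * D.PS.r q) := hball23 hy
    -- the time derivative of the cut-off expression at `y`
    have hline : (fun s ↦ f N s y) = fun s ↦ v (N + 1) s ((D.PS.chart q).inv y) := by
      funext s'; simp only [hf, PatchSystemLoc.cutExpr_of_mem D.PS _ hyt, hcut1 y hy, one_smul]
    have h1 : timeDerivWithin (Icc 0 T) (f N) s y = derivWithin (fun s ↦ v (N + 1) s ((D.PS.chart q).inv y)) (Icc 0 T) s := by
      rw [timeDerivWithin, hline]
    rw [h1, heq N s hs, hL _ (PatchSystemLoc.chartSmooth_slice D.PS (hvs (N + 1)) hs) q y hyt]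
    simp only [hgS3 y hy3, hgB3 y hy3, hgC3 y hy3, hΘN, PatchSystemLoc.zExpr_apply, hcP1 y hy3, one_smul]
    rw [frameOp_congr_of_eventuallyEq _ _ _ (hcutExpr_ev (v (N + 1) s) hy)]
  /- ## passage to the limit, word by word -/
  have hFu' : ∀ β : List E', TendstoUniformlyOn (fun N (p : ℝ × E') ↦ iterDirDeriv β (f N p.1) p.2) (fun p ↦ iterDirDeriv β (F p.1) p.2) atTop (Icc 0 T ×ˢ univ) :=
    fun β ↦ tendstoUniformlyOn_succ (hFu β)
  have hFsm' : ∀ (m : ℕ) (ε : ℝ), 0 < ε → ∃ N₀ : ℕ, ∀ N ≥ N₀, ∀ w : List (Fin (Module.finrank ℝ E')), w.length ≤ m →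
      ∀ t ∈ Icc 0 T, ∀ y, ‖iterDirDeriv (w.map (stdOrthonormalBasis ℝ E')) (f N t) y - iterDirDeriv (w.map (stdOrthonormalBasis ℝ E')) (F t) y‖ ≤ ε := by
    intro m ε hε
    obtain ⟨N₀, hN₀⟩ := hFsm m ε hε
    exact ⟨N₀, fun N hN w hw t ht y ↦ hN₀ (N + 1) (by omega) w hw t ht y⟩
  have hwordODE : ∀ (β : List E') {t : ℝ}, t ∈ Icc 0 T → ∀ {x : E'}, x ∈ ball (0 : E') (2 * D.PS.r q) →
      HasDerivWithinAt (fun s ↦ iterDirDeriv β (F s) x) (iterDirDeriv β (fun y ↦ frameOp (gS y) (gB y) (gC y) (F t) y + Θl t y) x) (Icc 0 T) t := by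
    intro β t ht x hx
    exact hasDerivWithinAt_words_of_limit' hT0 (S := fun _ ↦ gS) (𝔟 := fun _ ↦ gB) (𝔠 := fun _ ↦ gC)
      (isSmoothSpaceTimeOn_const_time hgSs _) (isSmoothSpaceTimeOn_const_time hgBs _) (isSmoothSpaceTimeOn_const_time hgCs _)
      hgSc hgBc hgCc hΘNs hΘls hfsm heqN hFs hFu' hFsm' hΘsm β ht hx
  /- ## identification of the limit source on the inner ball -/
  have hflat_smooth : ∀ t ∈ Icc 0 T, ContDiff ℝ ∞ (F t) := hFs
  have hjetN : ContDiff ℝ ∞ (jetFormN (D.Av q) (D.PS.cut q) (D.Gc q) (D.Gr q) (D.g₀ q)) :=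
    contDiff_jetFormN (D.Av q) (D.PS.cut q).contDiff (fun i i' ↦ D.contDiff_Gc q i i') (D.contDiff_Gr q) (D.contDiff_g₀ q)
  have hΘl_eq : ∀ t ∈ Icc 0 T, ∀ x ∈ ball (0 : E') (2 * D.PS.r q), Θl t x = D.flat q (F t) x := by
    intro t ht x hx
    have hxt : x ∈ (D.PS.chart q).target := hball2t hx
    have hx3 : x ∈ ball (0 : E') (3 * D.PS.r q) := hball23 hx
    -- the approximants as jet composites of the cut-off expressions
    have hN : ∀ N, ΘN N t x = jetFormN (D.Av q) (D.PS.cut q) (D.Gc q) (D.Gr q) (D.g₀ q) (x, jetW 2 (PatchSystemLoc.cutExpr D.PS q (v N t)) x) := by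
      intro N
      have hvq : ContDiffOn ℝ ∞ (v N t ∘ (D.PS.chart q).inv) (D.PS.chart q).target := PatchSystemLoc.chartSmooth_slice D.PS (hvs N) ht q
      have hz : ContDiff ℝ ∞ (PatchSystemLoc.zExpr D.PS q (v N t)) := PatchSystemLoc.contDiff_zExpr D.PS q hvq
      -- `ΘN N t x = Θ(v N t)(κ⁻¹ x) = cutExpr_q Θ(v N t) x = flat_q (z_q(v N t)) x`
      have h1 : ΘN N t x = PatchSystemLoc.cutExpr D.PS q (D.theta (v N t)) x := by
        simp only [hΘN, PatchSystemLoc.zExpr_apply, hcP1 x hx3, one_smul, PatchSystemLoc.cutExpr_of_mem D.PS _ hxt, hcut1 x hx]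
      rw [h1, D.cutExpr_theta_eq q (hslices N t ht).1 (hslices N t ht).2.1 ((hslices N t ht).2.2 q), PicardData.flat, ← jetFormN_jetW _ _ _ _ _ hz x]
      -- the jets of `z_q` and of `cutExpr_q` agree at `x`
      congr 2
      funext i
      simp only [jetW_apply]
      have hev : PatchSystemLoc.zExpr D.PS q (v N t) =ᶠ[𝓝 x] PatchSystemLoc.cutExpr D.PS q (v N t) :=
        (PatchSystemLoc.zExpr_eventuallyEq D.PS q (v N t) hx3).trans (hcutExpr_ev (v N t) hx).symm
      exact (eventuallyEq_iterDirDeriv hev _).eq_of_nhds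
    -- pass to the limit
    have hjlim : Tendsto (fun N ↦ jetW 2 (PatchSystemLoc.cutExpr D.PS q (v N t)) x) atTop (𝓝 (jetW 2 (F t) x)) := by
      rw [show (fun N ↦ jetW 2 (PatchSystemLoc.cutExpr D.PS q (v N t)) x) = fun N i ↦ iterDirDeriv (wordOf i) (PatchSystemLoc.cutExpr D.PS q (v N t)) x from rfl,
        show jetW 2 (F t) x = fun i ↦ iterDirDeriv (wordOf i) (F t) x from rfl]
      exact tendsto_pi_nhds.2 fun i ↦ (hFu (wordOf i)).tendsto_at (mk_mem_prod ht (mem_univ x))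
    have hlim2 : Tendsto (fun N ↦ ΘN N t x) atTop (𝓝 (jetFormN (D.Av q) (D.PS.cut q) (D.Gc q) (D.Gr q) (D.g₀ q) (x, jetW 2 (F t) x))) := by
      simp only [hN]
      exact (hjetN.continuous.tendsto _).comp (tendsto_const_nhds.prodMk_nhds hjlim)
    have hlim1 : Tendsto (fun N ↦ ΘN N t x) atTop (𝓝 (Θl t x)) := hΘllim t ht x
    rw [tendsto_nhds_unique hlim1 hlim2, PicardData.flat, ← jetFormN_jetW _ _ _ _ _ (hflat_smooth t ht) x]
  /- ## joint smoothness by the nonlinear tower -/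
  set Φ₀ : E' × Jet E' 2 W' → W' := fun qq ↦ jetFormL gS gB gC qq + jetFormN (D.Av q) (D.PS.cut q) (D.Gc q) (D.Gr q) (D.g₀ q) qq with hΦ₀
  have hΦ₀s : ContDiff ℝ ∞ Φ₀ := (contDiff_jetFormL hgSs hgBs hgCs).add hjetN
  have hrhs : ∀ t ∈ Icc 0 T, ∀ x ∈ ball (0 : E') (2 * D.PS.r q),
      (fun y ↦ frameOp (gS y) (gB y) (gC y) (F t) y + Θl t y) =ᶠ[𝓝 x] fun y ↦ Φ₀ (y, jetW 2 (F t) y) := by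
    intro t ht x hx
    filter_upwards [isOpen_ball.mem_nhds hx] with y hy
    rw [hΦ₀]
    simp only [jetFormL_jetW, jetFormN_jetW _ _ _ _ _ (hflat_smooth t ht) y, hΘl_eq t ht y hy, PicardData.flat]
  have hwd : ∀ β : List (Fin (Module.finrank ℝ E')), ∀ t ∈ Icc 0 T, ∀ x ∈ ball (0 : E') (2 * D.PS.r q),
      HasDerivWithinAt (fun s ↦ iterDirDeriv (β.map (stdOrthonormalBasis ℝ E')) (F s) x)
        (iterDirDeriv (β.map (stdOrthonormalBasis ℝ E')) (fun y ↦ Φ₀ (y, jetW 2 (F t) y)) x) (Icc 0 T) t := by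
    intro β t ht x hx
    have h := hwordODE (β.map (stdOrthonormalBasis ℝ E')) ht hx
    rwa [(eventuallyEq_iterDirDeriv (hrhs t ht x hx) _).eq_of_nhds] at h
  have hwc : ∀ β : List (Fin (Module.finrank ℝ E')), ContinuousOn (fun qq : ℝ × E' ↦ iterDirDeriv (β.map (stdOrthonormalBasis ℝ E')) (F qq.1) qq.2)
      (Icc 0 T ×ˢ ball (0 : E') (2 * D.PS.r q)) := fun β ↦ (hFc _).mono (prod_mono le_rfl (subset_univ _))
  have hFinf : ContDiffOn ℝ ∞ (uncurry F) (Icc 0 T ×ˢ ball (0 : E') (2 * D.PS.r q)) :=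
    JetTower.contDiffOn_slab_of_classical hT0 hFs hwc hΦ₀s hwd isOpen_ball
  /- ## conclusion -/
  refine ⟨F, hFlim, hFu, hFs, hFinf, fun t ht x hx ↦ ?_⟩
  have h := hwordODE [] ht hx
  simp only [iterDirDeriv_nil] at h
  rwa [hgS3 x (hball23 hx), hgB3 x (hball23 hx), hgC3 x (hball23 hx), hΘl_eq t ht x hx] at h

/-! ### The solution -/

set_option maxHeartbeats 4000000 in
/-- **Short-time solutions of the frozen Picard scheme.** Given the data `D`, linear existence in
the `linOp` form on the sub-slabs of `[0, 1]`, the weighted a priori estimate with an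
order-independent source constant, and the chart representation of the frozen operator, there are
`T > 0` and a chart-slab-smooth `v` on `[0, T]` with `v(0) = 0`, `u₀ + v(t)` with graph in `𝒪`,
and `∂ₜ (u₀ + v) = P(u₀ + v)` within `[0, T]` at every point. [cite: TaylorPDEIII2011, Ch. 15, §7] -/
theorem PicardData.exists_solution {Clin : ℝ≥0∞} (hClin : Clin ≠ ⊤)
    (hLin : ∀ {T' : ℝ}, 0 < T' → T' ≤ 1 → ∀ {Θ : ℝ → M → W'},
      (∀ q, ContDiffOn ℝ ∞ (uncurry fun s y ↦ Θ s ((D.PS.chart q).inv y)) (Icc 0 T' ×ˢ (D.PS.chart q).target)) →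
      ∃ v : ℝ → M → W', (∀ q, ContDiffOn ℝ ∞ (uncurry fun s y ↦ v s ((D.PS.chart q).inv y)) (Icc 0 T' ×ˢ (D.PS.chart q).target)) ∧
        (∀ x, v 0 x = 0) ∧ ∀ s ∈ Icc 0 T', ∀ x, derivWithin (fun s ↦ v s x) (Icc 0 T') s = linOp D.P D.u₀ (v s) x + Θ s x)
    (hAp : ∀ i : ℕ, ∃ Λ : ℝ, 1 ≤ Λ ∧ ∀ {lam : ℝ}, Λ ≤ lam → ∀ {T' : ℝ}, 0 < T' → T' ≤ 1 → ∀ {v g : ℝ → M → W'},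
      (∀ q, ContDiffOn ℝ ∞ (uncurry fun s y ↦ v s ((D.PS.chart q).inv y)) (Icc 0 T' ×ˢ (D.PS.chart q).target)) →
      (∀ x, v 0 x = 0) →
      (∀ q, ContDiffOn ℝ ∞ (uncurry fun s y ↦ g s ((D.PS.chart q).inv y)) (Icc 0 T' ×ˢ (D.PS.chart q).target)) →
      (∀ s ∈ Icc 0 T', ∀ x, derivWithin (fun s ↦ v s x) (Icc 0 T') s = linOp D.P D.u₀ (v s) x + g s x) →
      ∀ t ∈ Icc 0 T',
        (∑ p, PatchSystemLoc.maxRegQ i lam (fun s ↦ PatchSystemLoc.cutExpr D.PS p (v s)) t ≤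
          Clin * ∑ p, ∫⁻ s in Ioo 0 t, ENNReal.ofReal (Real.exp (-2 * lam * s)) * sobolevEnergy i (PatchSystemLoc.cutExpr D.PS p (g s))) ∧
        ∀ p, ENNReal.ofReal (Real.exp (-2 * lam * t)) * sobolevEnergy i (PatchSystemLoc.cutExpr D.PS p (v t)) ≤
          Clin * ENNReal.ofReal lam⁻¹ * ∑ p, ∫⁻ s in Ioo 0 t, ENNReal.ofReal (Real.exp (-2 * lam * s)) * sobolevEnergy i (PatchSystemLoc.cutExpr D.PS p (g s)))
    {S₀ : ι → E' → (E' →L[ℝ] E')} {𝔟₀ : ι → E' → ((E' →L[ℝ] W') →L[ℝ] W')} {𝔠₀ : ι → E' → (W' →L[ℝ] W')}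
    (hS₀ : ∀ q, ContDiffOn ℝ ∞ (S₀ q) (D.PS.chart q).target) (h𝔟₀ : ∀ q, ContDiffOn ℝ ∞ (𝔟₀ q) (D.PS.chart q).target)
    (h𝔠₀ : ∀ q, ContDiffOn ℝ ∞ (𝔠₀ q) (D.PS.chart q).target)
    (hL : ∀ u : M → W', (∀ q, ContDiffOn ℝ ∞ (u ∘ (D.PS.chart q).inv) (D.PS.chart q).target) →
      ∀ q, ∀ y ∈ (D.PS.chart q).target, linOp D.P D.u₀ u ((D.PS.chart q).inv y) = frameOp (S₀ q y) (𝔟₀ q y) (𝔠₀ q y) (u ∘ (D.PS.chart q).inv) y) :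
    ∃ T : ℝ, 0 < T ∧ ∃ v : ℝ → M → W',
      (∀ q, ContDiffOn ℝ ∞ (uncurry fun s y ↦ v s ((D.PS.chart q).inv y)) (Icc 0 T ×ˢ (D.PS.chart q).target)) ∧
      (∀ x, v 0 x = 0) ∧ (∀ t ∈ Icc 0 T, ∀ x, (x, D.u₀ x + v t x) ∈ D.𝒪) ∧
      ∀ t ∈ Icc 0 T, ∀ x, HasDerivWithinAt (fun s ↦ D.u₀ x + v s x) (D.P (fun x' ↦ D.u₀ x' + v t x') x) (Icc 0 T) t := by
  classical
  set m₀ : ℕ := 2 * (Module.finrank ℝ E' + 1) + 8 with hm₀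
  obtain ⟨T, hT0, hT1, ε₁, hε₁, lam₀, -, -, ⟨ε₀, hε₁ε₀, Cs, -, Cδ, hCδ0, hδ1, htop, hsmall⟩, v, hvs, hv0, hv00, heq, hE0, -⟩ :=
    D.exists_iterates hClin hLin hAp m₀ le_rfl
  -- chart limits
  have hch := fun q ↦ D.chart_limit_regular hClin hAp hS₀ h𝔟₀ h𝔠₀ hL (le_refl m₀) hT0 hT1 hε₁ hε₁ε₀ (Cs := Cs) hCδ0 hδ1 htop hsmall hvs hv0 hv00 heq hE0 q
  choose F hFlim hFu hFs hFinf hFode using hch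
  -- the limit on `M` through cover charts
  choose pc hpc using D.PS.cover
  set vl : ℝ → M → W' := fun t x ↦ F (pc x) t ((D.PS.chart (pc x)).map x) with hvl
  have hball2 : ∀ p, ball (0 : E') (D.PS.r p) ⊆ ball (0 : E') (2 * D.PS.r p) := fun p ↦ ball_subset_ball (by linarith [D.PS.r_pos p])
  have hvN : ∀ p x, x ∈ (D.PS.chart p).source → (D.PS.chart p).map x ∈ ball (0 : E') (2 * D.PS.r p) → ∀ t ∈ Icc 0 T,
      Tendsto (fun N ↦ v N t x) atTop (𝓝 (F p t ((D.PS.chart p).map x))) := by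
    intro p x hx hmx t ht
    have hc1 : D.PS.cut p ((D.PS.chart p).map x) = 1 := (D.PS.cut p).one_of_mem_closedBall (by rw [PatchSystem.cut_rIn]; exact ball_subset_closedBall hmx)
    have heqN : ∀ N, v N t x = PatchSystemLoc.cutExpr D.PS p (v N t) ((D.PS.chart p).map x) := fun N ↦ (PatchSystemLoc.cutExpr_map_of_cut_eq_one D.PS (v N t) hx hc1).symm
    simp only [heqN]
    exact hFlim p t ht _
  have hvlim : ∀ x, ∀ t ∈ Icc 0 T, Tendsto (fun N ↦ v N t x) atTop (𝓝 (vl t x)) := fun x t ht ↦ hvN (pc x) x (hpc x).1 (hball2 _ (hpc x).2) t ht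
  have hvchart : ∀ p x, x ∈ (D.PS.chart p).source → (D.PS.chart p).map x ∈ ball (0 : E') (2 * D.PS.r p) → ∀ t ∈ Icc 0 T,
      vl t x = F p t ((D.PS.chart p).map x) := fun p x hx hmx t ht ↦ tendsto_nhds_unique (hvlim x t ht) (hvN p x hx hmx t ht)
  have hvinv : ∀ p, ∀ t ∈ Icc 0 T, ∀ y ∈ ball (0 : E') (2 * D.PS.r p), vl t ((D.PS.chart p).inv y) = F p t y := by
    intro p t ht y hy
    have hyt : y ∈ (D.PS.chart p).target := D.PS.ball_subset_target p (by norm_num) hy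
    have h := hvchart p ((D.PS.chart p).inv y) ((D.PS.chart p).inv_mem_source hyt) (by rw [(D.PS.chart p).map_inv hyt]; exact hy) t ht
    rwa [(D.PS.chart p).map_inv hyt] at h
  -- chart-slab smoothness
  have hvsm : ∀ q, ContDiffOn ℝ ∞ (uncurry fun s y ↦ vl s ((D.PS.chart q).inv y)) (Icc 0 T ×ˢ (D.PS.chart q).target) :=
    chartSlabSmooth_of_cover D.PS (G := vl) (fun p ↦ uncurry (F p)) hFinf (fun p t ht yy hyy ↦ hvinv p t ht yy hyy)
  -- initial value
  have hvl0 : ∀ x, vl 0 x = 0 := by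
    intro x
    have h0 : (0 : ℝ) ∈ Icc 0 T := ⟨le_rfl, hT0.le⟩
    have h := hvlim x 0 h0
    simp only [hv0] at h
    exact tendsto_nhds_unique h tendsto_const_nhds
  -- the cut-off chart expressions of the limit are the chart limits
  have hcutlim : ∀ q, ∀ t ∈ Icc 0 T, PatchSystemLoc.cutExpr D.PS q (vl t) = F q t := by
    intro q t ht
    funext y
    by_cases hy : y ∈ (D.PS.chart q).target
    · rw [PatchSystemLoc.cutExpr_of_mem D.PS _ hy]
      have h1 : Tendsto (fun N ↦ PatchSystemLoc.cutExpr D.PS q (v N t) y) atTop (𝓝 (D.PS.cut q y • vl t ((D.PS.chart q).inv y))) := by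
        simp only [PatchSystemLoc.cutExpr_of_mem D.PS _ hy]
        exact (hvlim _ t ht).const_smul _
      exact tendsto_nhds_unique h1 (hFlim q t ht y)
    · rw [PatchSystemLoc.cutExpr_of_notMem D.PS _ hy]
      have h1 : Tendsto (fun N ↦ PatchSystemLoc.cutExpr D.PS q (v N t) y) atTop (𝓝 0) := by
        simp only [PatchSystemLoc.cutExpr_of_notMem D.PS _ hy]; exact tendsto_const_nhds
      exact tendsto_nhds_unique h1 (hFlim q t ht y)
  -- energies of the limit (Fatou) and the smallness package
  have hEl : ∀ t ∈ Icc 0 T, ∀ q, sobolevEnergy (m₀ + 2 * (Module.finrank ℝ E' + 1)) (PatchSystemLoc.cutExpr D.PS q (vl t)) ≤ ENNReal.ofReal (ε₁ ^ 2) := by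
    intro t ht q
    rw [hcutlim q t ht]
    refine sobolevEnergy_le_of_tendsto _ (f := fun N ↦ PatchSystemLoc.cutExpr D.PS q (v N t))
      (fun N ↦ (PatchSystemLoc.isSmoothSpaceTimeOn_cutExpr D.PS q (hvs N q)).contDiff_slice ht) (hFs q t ht) (fun β y ↦ ?_) (fun N ↦ hE0 N t ht q)
    exact (hFu q β).tendsto_at (mk_mem_prod ht (mem_univ y))
  have hvlsm : ∀ t ∈ Icc 0 T, ContMDiff I 𝓘(ℝ, W') ∞ (vl t) := fun t ht ↦ PatchSystemLoc.contMDiff_of_chartSmooth D.PS (PatchSystemLoc.chartSmooth_slice D.PS hvsm ht)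
  have hpack : ∀ t ∈ Icc 0 T, (∀ x, (x, D.u₀ x + vl t x) ∈ D.𝒪) ∧ (∀ p y, D.PS.cut p y ≠ 0 → jetQ (jetOf (vl t ∘ (D.PS.chart p).inv) y) ≤ D.ρ' ^ 2) := by
    intro t ht
    obtain ⟨hg, hj, -, -⟩ := hsmall (hvlsm t ht) hε₁.le hε₁ε₀ (hEl t ht)
    exact ⟨hg, hj⟩
  refine ⟨T, hT0, vl, hvsm, hvl0, fun t ht ↦ (hpack t ht).1, fun t ht x ↦ ?_⟩
  /- ## the equation at `(t, x)` through the cover chart of `x` -/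
  set p := pc x with hp
  set y : E' := (D.PS.chart p).map x with hy
  have hxs : x ∈ (D.PS.chart p).source := (hpc x).1
  have hyb : y ∈ ball (0 : E') (2 * D.PS.r p) := hball2 _ (hpc x).2
  have hyt : y ∈ (D.PS.chart p).target := (D.PS.chart p).map_mem_target hxs
  have hy3 : y ∈ ball (0 : E') (3 * D.PS.r p) := ball_subset_ball (by linarith [D.PS.r_pos p]) hyb
  have hxy : (D.PS.chart p).inv y = x := (D.PS.chart p).inv_map hxs
  have hode := hFode p t ht y hyb
  -- the time line of the limit is the time line of the chart limit
  have hline : ∀ s ∈ Icc 0 T, vl s x = F p s y := fun s hs ↦ hvchart p x hxs hyb s hs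
  have hode' : HasDerivWithinAt (fun s ↦ vl s x) (frameOp (S₀ p y) (𝔟₀ p y) (𝔠₀ p y) (F p t) y + D.flat p (F p t) y) (Icc 0 T) t :=
    hode.congr (fun s hs ↦ hline s hs) (hline t ht)
  -- identification of the right-hand side with `P (u₀ + vl t) x`
  have hnear : (vl t ∘ (D.PS.chart p).inv) =ᶠ[𝓝 y] F p t := by
    filter_upwards [isOpen_ball.mem_nhds hyb] with z hz
    exact hvinv p t ht z hz
  have hLx : linOp D.P D.u₀ (vl t) x = frameOp (S₀ p y) (𝔟₀ p y) (𝔠₀ p y) (F p t) y := by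
    rw [← hxy, hL _ (PatchSystemLoc.chartSmooth_slice D.PS hvsm ht) p y hyt]
    exact frameOp_congr_of_eventuallyEq _ _ _ hnear
  have hθx : D.theta (vl t) x = D.flat p (F p t) y := by
    have hid := D.cutExpr_theta_eq p (hvlsm t ht) (hpack t ht).1 ((hpack t ht).2 p)
    have hcut1 : D.PS.cut p y = 1 := (D.PS.cut p).one_of_mem_closedBall (by rw [PatchSystem.cut_rIn]; exact ball_subset_closedBall hyb)
    have h1 : PatchSystemLoc.cutExpr D.PS p (D.theta (vl t)) y = D.theta (vl t) x := by
      rw [PatchSystemLoc.cutExpr_of_mem D.PS _ hyt, hcut1, one_smul, hxy]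
    rw [← h1, hid]
    -- `flat_p (z_p (vl t)) y = flat_p (F p t) y`: the jets agree at `y`
    have hz : ContDiff ℝ ∞ (PatchSystemLoc.zExpr D.PS p (vl t)) := PatchSystemLoc.contDiff_zExpr D.PS p (PatchSystemLoc.chartSmooth_slice D.PS hvsm ht p)
    rw [PicardData.flat, PicardData.flat, ← jetFormN_jetW _ _ _ _ _ hz y, ← jetFormN_jetW _ _ _ _ _ (hFs p t ht) y]
    congr 2
    funext i
    simp only [jetW_apply]
    have hev : PatchSystemLoc.zExpr D.PS p (vl t) =ᶠ[𝓝 y] F p t := (PatchSystemLoc.zExpr_eventuallyEq D.PS p (vl t) hy3).trans hnear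
    exact (eventuallyEq_iterDirDeriv hev _).eq_of_nhds
  have hrhs : frameOp (S₀ p y) (𝔟₀ p y) (𝔠₀ p y) (F p t) y + D.flat p (F p t) y = D.P (fun x' ↦ D.u₀ x' + vl t x') x := by
    rw [← hLx, ← hθx, PicardData.theta]; abel
  rw [hrhs] at hode'
  exact hode'.const_add (D.u₀ x)

end Charts

end Literature.Analysis.PDE
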